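import Literature.RingTheory.FittingIdeal.BaseChange
import Literature.RingTheory.FittingIdeal.Functoriality
import Mathlib.LinearAlgebra.TensorProduct.Quotient
import Mathlib.Algebra.Module.Torsion.Basic
import Mathlib.Algebra.Algebra.Basic
import Mathlib.RingTheory.Ideal.Quotient.Operations
import Mathlib.RingTheory.TensorProduct.Basic
import HarnessLib

/-!
# Fitting ideals of `M ⧸ IM` over `R ⧸ I` (Stacks 07ZA (3), the case `R' = R/I`)

Topic: `Literature/RingTheory/FittingIdeal`. Companion to `BaseChange.lean`
(`Module.fittingIdeal_baseChange`: `Fitt_k(S ⊗_R M) = Fitt_k(M)·S`, Stacks 07ZA (3) / Eisenbud Cor. 20.5).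
The most used instance of base change is reduction modulo an ideal: for a finite `R`-module `M` and an
ideal `I ⊆ R`, the `R ⧸ I`-module `M ⧸ IM` (Mathlib's instance `Module (R ⧸ I) (M ⧸ I • ⊤)`) has

  `Fitt_k^{R/I}(M ⧸ IM) = Fitt_k^R(M) · (R ⧸ I)`,

i.e. the image of `Fitt_k(M)` under `R → R ⧸ I` (Stacks 07ZA (3) with `R' = R/I`, since
`M ⊗_R R/I = M/IM`; Northcott, *Finite free resolutions*, §3.1). PROVED here
(`Module.fittingIdeal_quotient_smul_top_eq_map`) by transporting `Module.fittingIdeal_baseChange` along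
Mathlib's `TensorProduct.quotTensorEquivQuotSMul : (R ⧸ I) ⊗_R M ≃ M ⧸ IM`, made `R ⧸ I`-linear by
`LinearEquiv.extendScalarsOfSurjective`. Consequence used by layer-by-layer ("equivariant") arguments over
`Λ ⧸ (ω_n) = ℤ_p[Γ/Γ_n]` in Iwasawa theory: **an element `θ ∈ R` whose residue lies in `Fitt_k^{R/I}(M ⧸ IM)`
lies in `Fitt_k^R(M) + I`** (`Module.mem_fittingIdeal_sup_of_mk_mem_fittingIdeal_quotient`, and the `iff`).

## Sources

* The Stacks Project, Tag 07ZA (3) ("If `M` is finite, then `Fitt_k(M ⊗_R R') = Fitt_k(M) R'`").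
  [StacksProject]
* D. Eisenbud, *Commutative Algebra with a View Toward Algebraic Geometry*, GTM 150, Cor. 20.5. [Eisenbud1995]

## Design

Theorems only (no definition, no named fact); one universe-polymorphic section; `noncomputable section`
(tensor products over quotient rings). Axioms: `propext`, `Classical.choice`, `Quot.sound`.
-/

noncomputable section

namespace Literature.RingTheory.FittingIdeal

open TensorProduct

universe u v

variable {R : Type u} [CommRing R] {M : Type v} [AddCommGroup M] [Module R M]

/-- **Stacks 07ZA (3) for `R' = R ⧸ I`: `Fitt_k^{R/I}(M ⧸ IM) = Fitt_k^R(M)·(R ⧸ I)`** — the Fitting ideals of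
the `R ⧸ I`-module `M ⧸ IM` of a finite `R`-module `M` are the images of those of `M` under `R → R ⧸ I`
(base change `Module.fittingIdeal_baseChange` along `(R ⧸ I) ⊗_R M ≃ M ⧸ IM`).
[cite: StacksProject, Tag 07ZA] -/
theorem Module.fittingIdeal_quotient_smul_top_eq_map [Module.Finite R M] (I : Ideal R) (k : ℕ) :
    Module.fittingIdeal (R ⧸ I) (M ⧸ (I • ⊤ : Submodule R M)) k =
      (Module.fittingIdeal R M k).map (Ideal.Quotient.mk I) := by
  have hs : Function.Surjective (algebraMap R (R ⧸ I)) := Ideal.Quotient.mk_surjective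
  have e : ((R ⧸ I) ⊗[R] M) ≃ₗ[R ⧸ I] M ⧸ (I • ⊤ : Submodule R M) :=
    LinearEquiv.extendScalarsOfSurjective hs (quotTensorEquivQuotSMul M I)
  rw [← Module.fittingIdeal_eq_of_linearEquiv e k, Module.fittingIdeal_baseChange]
  rfl

/-- **Lifting a Fitting membership from `R ⧸ I` to `R`**: for a finite `R`-module `M`, an ideal `I` and
`θ ∈ R`, the residue `θ mod I` lies in `Fitt_k^{R/I}(M ⧸ IM)` IFF `θ ∈ Fitt_k^R(M) + I`
(`Fitt_k^{R/I}(M ⧸ IM)` is the image of `Fitt_k^R(M)`, whose preimage is `Fitt_k^R(M) + ker = Fitt_k^R(M) + I`).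
[cite: StacksProject, Tag 07ZA] -/
theorem Module.mk_mem_fittingIdeal_quotient_iff [Module.Finite R M] (I : Ideal R) (k : ℕ) (θ : R) :
    Ideal.Quotient.mk I θ ∈ Module.fittingIdeal (R ⧸ I) (M ⧸ (I • ⊤ : Submodule R M)) k ↔
      θ ∈ Module.fittingIdeal R M k ⊔ I := by
  rw [Module.fittingIdeal_quotient_smul_top_eq_map, ← Ideal.mem_comap,
    Ideal.comap_map_of_surjective _ Ideal.Quotient.mk_surjective, ← RingHom.ker_eq_comap_bot,
    Ideal.mk_ker]

/-- **An element whose residue lies in `Fitt_k^{R/I}(M ⧸ IM)` lies in `Fitt_k^R(M) + I`** — the form in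
which a Fitting-ideal statement proved over the quotient ring `R ⧸ I` (e.g. over `Λ ⧸ (ω_n) = ℤ_p[Γ/Γ_n]` at
the `n`-th layer of a `ℤ_p`-tower) is read back in `R`. [cite: StacksProject, Tag 07ZA] -/
theorem Module.mem_fittingIdeal_sup_of_mk_mem_fittingIdeal_quotient [Module.Finite R M] (I : Ideal R)
    (k : ℕ) {θ : R}
    (hθ : Ideal.Quotient.mk I θ ∈ Module.fittingIdeal (R ⧸ I) (M ⧸ (I • ⊤ : Submodule R M)) k) :
    θ ∈ Module.fittingIdeal R M k ⊔ I :=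
  (Module.mk_mem_fittingIdeal_quotient_iff I k θ).mp hθ

/-- The converse direction as a map: `Fitt_k^R(M) → Fitt_k^{R/I}(M ⧸ IM)`, `θ ↦ θ mod I`.
[cite: StacksProject, Tag 07ZA] -/
theorem Module.mk_mem_fittingIdeal_quotient_of_mem [Module.Finite R M] (I : Ideal R) (k : ℕ) {θ : R}
    (hθ : θ ∈ Module.fittingIdeal R M k) :
    Ideal.Quotient.mk I θ ∈ Module.fittingIdeal (R ⧸ I) (M ⧸ (I • ⊤ : Submodule R M)) k :=
  (Module.mk_mem_fittingIdeal_quotient_iff I k θ).mpr (Ideal.mem_sup_left hθ)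


/-! ## Any compatible `R ⧸ I`-module structure (modules killed by `I`) -/

section TorsionModule

variable {N : Type v} [AddCommGroup N] [Module R N] (I : Ideal R) [Module (R ⧸ I) N] [IsScalarTower R (R ⧸ I) N]

/-- An `R`-module carrying a compatible `R ⧸ I`-module structure is killed by `I`: `I • N = 0`
(`r • n = (r mod I) • n`). [folklore] -/
private theorem ideal_smul_top_eq_bot_of_isScalarTower : (I • ⊤ : Submodule R N) = ⊥ := by
  rw [eq_bot_iff, Submodule.smul_le]
  intro r hr n _
  rw [Submodule.mem_bot, ← IsScalarTower.algebraMap_smul (R ⧸ I) r n, Ideal.Quotient.algebraMap_eq,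
    Ideal.Quotient.eq_zero_iff_mem.mpr hr, zero_smul]

/-- **Stacks 07ZA (3) for any `I`-torsion module**: if the finite `R`-module `N` carries an `R ⧸ I`-module
structure compatible with its `R`-structure (`IsScalarTower R (R ⧸ I) N` — e.g. Mathlib's structure on
`M ⧸ IM`, `Module.IsTorsionBySet.module`, or the layer Selmer duals of a `ℤ_p`-tower as modules over
`Λ ⧸ (ω_n) = ℤ_p[Γ/Γ_n]`), then `Fitt_k^{R/I}(N) = Fitt_k^R(N)·(R ⧸ I)`: `N = N ⧸ IN` (`IN = 0`) and
`Module.fittingIdeal_quotient_smul_top_eq_map`. [cite: StacksProject, Tag 07ZA] -/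
theorem Module.fittingIdeal_quotientRing_eq_map [Module.Finite R N] (k : ℕ) :
    Module.fittingIdeal (R ⧸ I) N k = (Module.fittingIdeal R N k).map (Ideal.Quotient.mk I) := by
  have hs : Function.Surjective (algebraMap R (R ⧸ I)) := Ideal.Quotient.mk_surjective
  -- `N ⧸ IN ≃ N` over `R`, hence over `R ⧸ I`
  have e : (N ⧸ (I • ⊤ : Submodule R N)) ≃ₗ[R ⧸ I] N :=
    LinearEquiv.extendScalarsOfSurjective hs
      (Submodule.quotEquivOfEqBot _ (ideal_smul_top_eq_bot_of_isScalarTower I))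
  rw [← Module.fittingIdeal_eq_of_linearEquiv e k, Module.fittingIdeal_quotient_smul_top_eq_map]

/-- **Residue form**: `θ mod I ∈ Fitt_k^{R/I}(N) ↔ θ ∈ Fitt_k^R(N) + I`, for any compatible `R ⧸ I`-structure on
the finite `R`-module `N`. [cite: StacksProject, Tag 07ZA] -/
theorem Module.mk_mem_fittingIdeal_quotientRing_iff [Module.Finite R N] (k : ℕ) (θ : R) :
    Ideal.Quotient.mk I θ ∈ Module.fittingIdeal (R ⧸ I) N k ↔ θ ∈ Module.fittingIdeal R N k ⊔ I := by
  rw [Module.fittingIdeal_quotientRing_eq_map, ← Ideal.mem_comap,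
    Ideal.comap_map_of_surjective _ Ideal.Quotient.mk_surjective, ← RingHom.ker_eq_comap_bot,
    Ideal.mk_ker]

/-- **Transport along `R`-linear isomorphisms**: two finite `R`-modules killed by `I`, each with a compatible
`R ⧸ I`-structure, that are `R`-linearly isomorphic have the same Fitting ideals OVER `R ⧸ I` (both equal the
image of the common `Fitt_k^R`). For the layers of a `ℤ_p`-tower: `Fitt^{Λ/(ω_n)}` of the layer Selmer dual
`Hom(Sel(K_n), ℚ/ℤ)` equals `Fitt^{Λ/(ω_n)}` of `X ⧸ ω_n X` as soon as control gives `X ⧸ ω_n X ≅ₗ[Λ] Hom(Sel(K_n), ℚ/ℤ)`.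
[cite: StacksProject, Tag 07ZA] -/
theorem Module.fittingIdeal_quotientRing_eq_of_linearEquiv [Module.Finite R N] {N' : Type*} [AddCommGroup N']
    [Module R N'] [Module (R ⧸ I) N'] [IsScalarTower R (R ⧸ I) N'] (e : N ≃ₗ[R] N') (k : ℕ) :
    Module.fittingIdeal (R ⧸ I) N k = Module.fittingIdeal (R ⧸ I) N' k := by
  haveI : Module.Finite R N' := Module.Finite.equiv e
  rw [Module.fittingIdeal_quotientRing_eq_map I, Module.fittingIdeal_quotientRing_eq_map I,
    Module.fittingIdeal_eq_of_linearEquiv e k]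

end TorsionModule

end Literature.RingTheory.FittingIdeal

end
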